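import Mathlib
import Literature.Analysis.FluidPDE.VectorCalculus
import Literature.Analysis.FluidPDE.VortexFilament.CurlEnergy
import Summits.NavierStokesRegularity.NavierStokesRegularity.Theorems.FilamentSkeletonRssSelectionBoxRJRungStraightSkewTools
import Summits.NavierStokesRegularity.NavierStokesRegularity.Theorems.FilamentSkeletonRssSkeletonJ1GStubStraightDatumSlip

/-!
# `FilamentSkeletonRss` · crux `SkeletonJ1G` (stmt-NavierStokesRegularity-27849) · line `near_straight_newton` ·
# stub `stub_straightDatum` PROVED: an exact, fully rational straight skew datum exists

Registered stub S1 of the skeleton of record `Cruxes/SkeletonJ1/Lines/near_straight_newton.lean` (crux-strategist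
cstrat-27413, sha16 `425a2bdc735ccf75`, registered on stmt-27849 by the tenure planner g13), with the statement
`StraightDatumExists` — and the predicate `StraightDatum` inside it — UNFOLDED VERBATIM (the line file is not importable
from `Theorems/`), so that the line's `sorry` at `stub_straightDatum` closes by
`exact Summit.NavierStokesRegularity.NavierStokesRegularity.Theorems.FilamentSkeletonRssSkeletonJ1GStubStraightDatum.stub_straightDatum`.

THE WITNESS (the exact rational member of the strategist's design law, `Lines/near_straight_newton_design.md` §2;
`N = 2`).  Two straight skew lines in waist units `y/√Γ`,
`p₀ = (2/25, 0, 0)`, `t₀ = (0, 3/5, 4/5)`, `p₁ = (−2/25, 0, 0)`, `t₁ = (0, −3/5, 4/5)`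
(separation `d = ρ = 4/25` along the common perpendicular `e₁`, tilt `cos θ = 4/5`, `sin θ = 3/5`, `sin 2θ = 24/25`),
equal circulation parameters `γ₀ = γ₁ = 125π/108`, frame rate `α = 875/432`, zeros `s₀ = −1/2` on both lines.  By the
`R_π` symmetry `(x, y, z) ↦ (−x, −y, z)` both lines have the SAME scaled slip, and it is computed here in closed form from
the predicate's own formula (closed-form line Biot–Savart of the partner + frame drift; everything is rational because
`γ/(2π) = 125/216`):

  `W(s) = (125/36)/(1 + 36 s²) + s/2 − 7/72 = (1/12)·F(6s)`,  `F(u) = (125/3)/(1 + u²) + u − 7/6`,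

with `F(−3) = 0`, `F′(−3) = 7/2`.  Hence: zero at `s₀ = −1/2`, unique (`F ≷ 0` to the right/left of `−3`),
transversality `(1/10)|s + 1/2| ≤ |W(s)|` (from `|F(u)| ≥ |u + 3|/5`), supercritical slope `W′(s₀) = 7/4 = 3/2 + δ` with
`δ = 1/4`, and `|W′| ≤ 22 =: Λ` (from the crude `|F′| ≤ 128/3`).  Remaining constants: `ρ = 4/25`, `θ₀ = 1/6`
(`|⟪t, e₃⟫| = 4/5 ≤ 5/6`, `1/6 ≤ α, γ ≤ 6` using `3 < π < 4`), `Rw = 3/5` (`‖p + s₀ t‖² = 641/2500`), `mw = 1/10`.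

CREDIT.  The one-variable facts about `F` and `W` are part 1/2, `…Theorems.FilamentSkeletonRssSkeletonJ1GStubStraightDatumSlip`
(a port of the strategist's sorry-free `Cruxes/SkeletonJ1/Lines/near_straight_newton_datum.lean`,
planner-cstrat-stmt-NavierStokesRegularity-27413-s1-g2-0); the 3-vector reduction (§1) and the assembly (§2) are this
file's (lane ns-filament-19175-p1 g11).  Tools: `…Theorems.SelectionBoxRJRung.{inner_vec3, cross_vec3, add_vec3, sub_vec3, smul_vec3,
single_two_eq_vec3}` (lane 19175-p1 g5) and `VortexFilament.norm_sq_toLp_three`.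

HONEST FRAMING.  A Γ-free, finite-dimensional datum for a HYPOTHETICAL filament-skeleton construction on the NEGATIVE
side of a MODEL route; route-independent real/vector algebra (no `Theses` import).  Nothing here is a claim about
Navier–Stokes regularity or blow-up; no crux and no summit statement is proved by this file.
-/

set_option linter.dupNamespace false

noncomputable section

namespace Summit.NavierStokesRegularity.NavierStokesRegularity.Theorems.FilamentSkeletonRssSkeletonJ1GStubStraightDatum

open Set Function Filter MeasureTheory Real
open Literature.Analysis.FluidPDE
open scoped InnerProductSpace Topology BigOperators
open Summit.NavierStokesRegularity.NavierStokesRegularity.Theorems.SelectionBoxRJRung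
open Summit.NavierStokesRegularity.NavierStokesRegularity.Theorems.FilamentSkeletonRssSkeletonJ1GStubStraightDatumSlip

/-! ### §1 The explicit skew pair: unit tangents, separation, tilt, waist, and the closed-form slip on each line -/

/-- `‖t₀‖ = 1` for `t₀ = (0, 3/5, 4/5)`. [folklore] -/
theorem norm_tangent_zero : ‖(WithLp.toLp 2 ![0, 3 / 5, 4 / 5] : EuclideanSpace ℝ (Fin 3))‖ = 1 := by
  have h : ‖(WithLp.toLp 2 ![0, 3 / 5, 4 / 5] : EuclideanSpace ℝ (Fin 3))‖ ^ 2 = 1 := by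
    rw [VortexFilament.norm_sq_toLp_three]; norm_num
  nlinarith [h, norm_nonneg (WithLp.toLp 2 ![0, 3 / 5, 4 / 5] : EuclideanSpace ℝ (Fin 3))]

/-- `‖t₁‖ = 1` for `t₁ = (0, −3/5, 4/5)`. [folklore] -/
theorem norm_tangent_one : ‖(WithLp.toLp 2 ![0, -(3 / 5), 4 / 5] : EuclideanSpace ℝ (Fin 3))‖ = 1 := by
  have h : ‖(WithLp.toLp 2 ![0, -(3 / 5), 4 / 5] : EuclideanSpace ℝ (Fin 3))‖ ^ 2 = 1 := by
    rw [VortexFilament.norm_sq_toLp_three]; norm_num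
  nlinarith [h, norm_nonneg (WithLp.toLp 2 ![0, -(3 / 5), 4 / 5] : EuclideanSpace ℝ (Fin 3))]

/-- SEPARATION: points of line 0 and line 1 are at distance `≥ 4/25` (their `e₁`-coordinates differ by `4/25`).
[folklore] -/
theorem separation_zero_one (τ σ : ℝ) :
    4 / 25 ≤ ‖((WithLp.toLp 2 ![2 / 25, 0, 0] : EuclideanSpace ℝ (Fin 3)) + τ • WithLp.toLp 2 ![0, 3 / 5, 4 / 5]) -
      ((WithLp.toLp 2 ![-(2 / 25), 0, 0] : EuclideanSpace ℝ (Fin 3)) + σ • WithLp.toLp 2 ![0, -(3 / 5), 4 / 5])‖ := by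
  have hsq : (4 / 25 : ℝ) ^ 2 ≤
      ‖((WithLp.toLp 2 ![2 / 25, 0, 0] : EuclideanSpace ℝ (Fin 3)) + τ • WithLp.toLp 2 ![0, 3 / 5, 4 / 5]) -
        ((WithLp.toLp 2 ![-(2 / 25), 0, 0] : EuclideanSpace ℝ (Fin 3)) + σ • WithLp.toLp 2 ![0, -(3 / 5), 4 / 5])‖ ^ 2 := by
    rw [smul_vec3, smul_vec3, add_vec3, add_vec3, sub_vec3, VortexFilament.norm_sq_toLp_three]
    nlinarith [sq_nonneg (3 / 5 * τ + 3 / 5 * σ), sq_nonneg (4 / 5 * τ - 4 / 5 * σ)]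
  have hn := norm_nonneg (((WithLp.toLp 2 ![2 / 25, 0, 0] : EuclideanSpace ℝ (Fin 3)) + τ • WithLp.toLp 2 ![0, 3 / 5, 4 / 5]) -
      ((WithLp.toLp 2 ![-(2 / 25), 0, 0] : EuclideanSpace ℝ (Fin 3)) + σ • WithLp.toLp 2 ![0, -(3 / 5), 4 / 5]))
  by_contra h
  rw [not_le] at h
  nlinarith [hsq, hn, h]

/-- SEPARATION, the other ordering. [folklore] -/
theorem separation_one_zero (τ σ : ℝ) :
    4 / 25 ≤ ‖((WithLp.toLp 2 ![-(2 / 25), 0, 0] : EuclideanSpace ℝ (Fin 3)) + τ • WithLp.toLp 2 ![0, -(3 / 5), 4 / 5]) -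
      ((WithLp.toLp 2 ![2 / 25, 0, 0] : EuclideanSpace ℝ (Fin 3)) + σ • WithLp.toLp 2 ![0, 3 / 5, 4 / 5])‖ := by
  rw [← norm_neg, neg_sub]
  exact separation_zero_one σ τ

/-- WAIST on line 0: `‖p₀ + s₀ t₀‖ ≤ 3/5` (`‖·‖² = 641/2500`). [folklore] -/
theorem waist_zero :
    ‖(WithLp.toLp 2 ![2 / 25, 0, 0] : EuclideanSpace ℝ (Fin 3)) + (-1 / 2 : ℝ) • WithLp.toLp 2 ![0, 3 / 5, 4 / 5]‖ ≤ 3 / 5 := by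
  have hsq : ‖(WithLp.toLp 2 ![2 / 25, 0, 0] : EuclideanSpace ℝ (Fin 3)) + (-1 / 2 : ℝ) • WithLp.toLp 2 ![0, 3 / 5, 4 / 5]‖ ^ 2
      ≤ (3 / 5 : ℝ) ^ 2 := by
    rw [smul_vec3, add_vec3, VortexFilament.norm_sq_toLp_three]; norm_num
  have hn := norm_nonneg ((WithLp.toLp 2 ![2 / 25, 0, 0] : EuclideanSpace ℝ (Fin 3)) + (-1 / 2 : ℝ) • WithLp.toLp 2 ![0, 3 / 5, 4 / 5])
  by_contra h
  rw [not_le] at h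
  nlinarith [hsq, hn, h]

/-- WAIST on line 1: `‖p₁ + s₀ t₁‖ ≤ 3/5`. [folklore] -/
theorem waist_one :
    ‖(WithLp.toLp 2 ![-(2 / 25), 0, 0] : EuclideanSpace ℝ (Fin 3)) + (-1 / 2 : ℝ) • WithLp.toLp 2 ![0, -(3 / 5), 4 / 5]‖ ≤ 3 / 5 := by
  have hsq : ‖(WithLp.toLp 2 ![-(2 / 25), 0, 0] : EuclideanSpace ℝ (Fin 3)) + (-1 / 2 : ℝ) • WithLp.toLp 2 ![0, -(3 / 5), 4 / 5]‖ ^ 2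
      ≤ (3 / 5 : ℝ) ^ 2 := by
    rw [smul_vec3, add_vec3, VortexFilament.norm_sq_toLp_three]; norm_num
  have hn := norm_nonneg ((WithLp.toLp 2 ![-(2 / 25), 0, 0] : EuclideanSpace ℝ (Fin 3)) + (-1 / 2 : ℝ) • WithLp.toLp 2 ![0, -(3 / 5), 4 / 5])
  by_contra h
  rw [not_le] at h
  nlinarith [hsq, hn, h]

/-- TILT of `t₀`: `|⟪t₀, e₃⟫| = 4/5 ≤ 1 − 1/6`. [folklore] -/
theorem tilt_zero :
    |⟪(WithLp.toLp 2 ![0, 3 / 5, 4 / 5] : EuclideanSpace ℝ (Fin 3)), EuclideanSpace.single 2 1⟫_ℝ| ≤ 1 - 1 / 6 := by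
  rw [single_two_eq_vec3, inner_vec3]; norm_num [abs_of_pos]

/-- TILT of `t₁`: `|⟪t₁, e₃⟫| = 4/5 ≤ 1 − 1/6`. [folklore] -/
theorem tilt_one :
    |⟪(WithLp.toLp 2 ![0, -(3 / 5), 4 / 5] : EuclideanSpace ℝ (Fin 3)), EuclideanSpace.single 2 1⟫_ℝ| ≤ 1 - 1 / 6 := by
  rw [single_two_eq_vec3, inner_vec3]; norm_num [abs_of_pos]

/-- PARAMETER BOUNDS for `γ = 125π/108` with `θ₀ = 1/6` (uses `3 < π < 4`). [folklore] -/
theorem gamma_bounds : (1 / 6 : ℝ) ≤ |125 * Real.pi / 108| ∧ |125 * Real.pi / 108| ≤ (1 / 6 : ℝ)⁻¹ := by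
  have h3 := Real.pi_gt_three
  have h4 := Real.pi_lt_four
  rw [abs_of_pos (by positivity)]
  constructor
  · linarith
  · norm_num; linarith

/-- **CLOSED-FORM SLIP ON LINE 0.**  With `x = p₀ + s t₀`, partner line `(p₁, t₁)`, `γ₁ = 125π/108`, `α = 875/432`:
the predicate's scaled slip `⟪(γ₁/2π)·|D|⁻²·(t₁ × D) + ½x − α e₃ × x, t₀⟫`, `D = (x − p₁) − ⟪x − p₁, t₁⟫t₁`, equals
`(125/36)/(1 + 36 s²) + s/2 − 7/72`.  (`⟪x − p₁, t₁⟫ = 7s/25`, `D = (4/25, 96s/125, 72s/125)`, `|D|² = (16/625)(1+36s²)`,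
`⟪t₁ × D, t₀⟫ = 96/625`, `⟪x, t₀⟫ = s`, `⟪e₃ × x, t₀⟫ = 6/125`.) [folklore] -/
theorem slip_closed_form_zero (s : ℝ) :
    ⟪(125 * Real.pi / 108 / (2 * Real.pi)) •
        ((‖((WithLp.toLp 2 ![2 / 25, 0, 0] : EuclideanSpace ℝ (Fin 3)) + s • WithLp.toLp 2 ![0, 3 / 5, 4 / 5]
              - WithLp.toLp 2 ![-(2 / 25), 0, 0]) -
            ⟪(WithLp.toLp 2 ![2 / 25, 0, 0] : EuclideanSpace ℝ (Fin 3)) + s • WithLp.toLp 2 ![0, 3 / 5, 4 / 5]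
                - WithLp.toLp 2 ![-(2 / 25), 0, 0], (WithLp.toLp 2 ![0, -(3 / 5), 4 / 5] : EuclideanSpace ℝ (Fin 3))⟫_ℝ •
              (WithLp.toLp 2 ![0, -(3 / 5), 4 / 5] : EuclideanSpace ℝ (Fin 3))‖ ^ 2)⁻¹ •
          cross (WithLp.toLp 2 ![0, -(3 / 5), 4 / 5])
            (((WithLp.toLp 2 ![2 / 25, 0, 0] : EuclideanSpace ℝ (Fin 3)) + s • WithLp.toLp 2 ![0, 3 / 5, 4 / 5]
                - WithLp.toLp 2 ![-(2 / 25), 0, 0]) -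
              ⟪(WithLp.toLp 2 ![2 / 25, 0, 0] : EuclideanSpace ℝ (Fin 3)) + s • WithLp.toLp 2 ![0, 3 / 5, 4 / 5]
                  - WithLp.toLp 2 ![-(2 / 25), 0, 0], (WithLp.toLp 2 ![0, -(3 / 5), 4 / 5] : EuclideanSpace ℝ (Fin 3))⟫_ℝ •
                (WithLp.toLp 2 ![0, -(3 / 5), 4 / 5] : EuclideanSpace ℝ (Fin 3)))) +
        (1 / 2 : ℝ) • ((WithLp.toLp 2 ![2 / 25, 0, 0] : EuclideanSpace ℝ (Fin 3)) + s • WithLp.toLp 2 ![0, 3 / 5, 4 / 5]) -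
        (875 / 432 : ℝ) • cross (EuclideanSpace.single 2 1)
          ((WithLp.toLp 2 ![2 / 25, 0, 0] : EuclideanSpace ℝ (Fin 3)) + s • WithLp.toLp 2 ![0, 3 / 5, 4 / 5]),
      (WithLp.toLp 2 ![0, 3 / 5, 4 / 5] : EuclideanSpace ℝ (Fin 3))⟫_ℝ
      = 125 / 36 / (1 + 36 * s ^ 2) + s / 2 - 7 / 72 := by
  have h1 : ⟪(WithLp.toLp 2 ![2 / 25, 0, 0] : EuclideanSpace ℝ (Fin 3)) + s • WithLp.toLp 2 ![0, 3 / 5, 4 / 5]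
      - WithLp.toLp 2 ![-(2 / 25), 0, 0], (WithLp.toLp 2 ![0, -(3 / 5), 4 / 5] : EuclideanSpace ℝ (Fin 3))⟫_ℝ = 7 * s / 25 := by
    rw [smul_vec3, add_vec3, sub_vec3, inner_vec3]; ring
  have h2 : ‖((WithLp.toLp 2 ![2 / 25, 0, 0] : EuclideanSpace ℝ (Fin 3)) + s • WithLp.toLp 2 ![0, 3 / 5, 4 / 5]
        - WithLp.toLp 2 ![-(2 / 25), 0, 0]) - (7 * s / 25) • (WithLp.toLp 2 ![0, -(3 / 5), 4 / 5] : EuclideanSpace ℝ (Fin 3))‖ ^ 2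
      = 16 / 625 * (1 + 36 * s ^ 2) := by
    rw [smul_vec3, smul_vec3, add_vec3, sub_vec3, sub_vec3, VortexFilament.norm_sq_toLp_three]; ring
  have h3 : ⟪cross (WithLp.toLp 2 ![0, -(3 / 5), 4 / 5])
        (((WithLp.toLp 2 ![2 / 25, 0, 0] : EuclideanSpace ℝ (Fin 3)) + s • WithLp.toLp 2 ![0, 3 / 5, 4 / 5]
          - WithLp.toLp 2 ![-(2 / 25), 0, 0]) - (7 * s / 25) • (WithLp.toLp 2 ![0, -(3 / 5), 4 / 5] : EuclideanSpace ℝ (Fin 3))),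
      (WithLp.toLp 2 ![0, 3 / 5, 4 / 5] : EuclideanSpace ℝ (Fin 3))⟫_ℝ = 96 / 625 := by
    rw [smul_vec3, smul_vec3, add_vec3, sub_vec3, sub_vec3, cross_vec3, inner_vec3]; ring
  have h4 : ⟪(WithLp.toLp 2 ![2 / 25, 0, 0] : EuclideanSpace ℝ (Fin 3)) + s • WithLp.toLp 2 ![0, 3 / 5, 4 / 5],
      (WithLp.toLp 2 ![0, 3 / 5, 4 / 5] : EuclideanSpace ℝ (Fin 3))⟫_ℝ = s := by
    rw [smul_vec3, add_vec3, inner_vec3]; ring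
  have h5 : ⟪cross (EuclideanSpace.single 2 1)
        ((WithLp.toLp 2 ![2 / 25, 0, 0] : EuclideanSpace ℝ (Fin 3)) + s • WithLp.toLp 2 ![0, 3 / 5, 4 / 5]),
      (WithLp.toLp 2 ![0, 3 / 5, 4 / 5] : EuclideanSpace ℝ (Fin 3))⟫_ℝ = 6 / 125 := by
    rw [single_two_eq_vec3, smul_vec3, add_vec3, cross_vec3, inner_vec3]; ring
  rw [h1, inner_sub_left, inner_add_left, real_inner_smul_left, real_inner_smul_left, real_inner_smul_left,
    real_inner_smul_left, h2, h3, h4, h5]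
  have hπ : Real.pi ≠ 0 := Real.pi_ne_zero
  have hq : (1 : ℝ) + 36 * s ^ 2 ≠ 0 := by positivity
  field_simp
  ring

/-- **CLOSED-FORM SLIP ON LINE 1** (the `R_π` image): with `x = p₁ + s t₁`, partner line `(p₀, t₀)`, the predicate's
scaled slip equals the same `(125/36)/(1 + 36 s²) + s/2 − 7/72`.  (`⟪x − p₀, t₀⟫ = 7s/25`,
`D = (−4/25, −96s/125, 72s/125)`, `⟪t₀ × D, t₁⟫ = 96/625`, `⟪x, t₁⟫ = s`, `⟪e₃ × x, t₁⟫ = 6/125`.) [folklore] -/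
theorem slip_closed_form_one (s : ℝ) :
    ⟪(125 * Real.pi / 108 / (2 * Real.pi)) •
        ((‖((WithLp.toLp 2 ![-(2 / 25), 0, 0] : EuclideanSpace ℝ (Fin 3)) + s • WithLp.toLp 2 ![0, -(3 / 5), 4 / 5]
              - WithLp.toLp 2 ![2 / 25, 0, 0]) -
            ⟪(WithLp.toLp 2 ![-(2 / 25), 0, 0] : EuclideanSpace ℝ (Fin 3)) + s • WithLp.toLp 2 ![0, -(3 / 5), 4 / 5]
                - WithLp.toLp 2 ![2 / 25, 0, 0], (WithLp.toLp 2 ![0, 3 / 5, 4 / 5] : EuclideanSpace ℝ (Fin 3))⟫_ℝ •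
              (WithLp.toLp 2 ![0, 3 / 5, 4 / 5] : EuclideanSpace ℝ (Fin 3))‖ ^ 2)⁻¹ •
          cross (WithLp.toLp 2 ![0, 3 / 5, 4 / 5])
            (((WithLp.toLp 2 ![-(2 / 25), 0, 0] : EuclideanSpace ℝ (Fin 3)) + s • WithLp.toLp 2 ![0, -(3 / 5), 4 / 5]
                - WithLp.toLp 2 ![2 / 25, 0, 0]) -
              ⟪(WithLp.toLp 2 ![-(2 / 25), 0, 0] : EuclideanSpace ℝ (Fin 3)) + s • WithLp.toLp 2 ![0, -(3 / 5), 4 / 5]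
                  - WithLp.toLp 2 ![2 / 25, 0, 0], (WithLp.toLp 2 ![0, 3 / 5, 4 / 5] : EuclideanSpace ℝ (Fin 3))⟫_ℝ •
                (WithLp.toLp 2 ![0, 3 / 5, 4 / 5] : EuclideanSpace ℝ (Fin 3)))) +
        (1 / 2 : ℝ) • ((WithLp.toLp 2 ![-(2 / 25), 0, 0] : EuclideanSpace ℝ (Fin 3)) + s • WithLp.toLp 2 ![0, -(3 / 5), 4 / 5]) -
        (875 / 432 : ℝ) • cross (EuclideanSpace.single 2 1)
          ((WithLp.toLp 2 ![-(2 / 25), 0, 0] : EuclideanSpace ℝ (Fin 3)) + s • WithLp.toLp 2 ![0, -(3 / 5), 4 / 5]),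
      (WithLp.toLp 2 ![0, -(3 / 5), 4 / 5] : EuclideanSpace ℝ (Fin 3))⟫_ℝ
      = 125 / 36 / (1 + 36 * s ^ 2) + s / 2 - 7 / 72 := by
  have h1 : ⟪(WithLp.toLp 2 ![-(2 / 25), 0, 0] : EuclideanSpace ℝ (Fin 3)) + s • WithLp.toLp 2 ![0, -(3 / 5), 4 / 5]
      - WithLp.toLp 2 ![2 / 25, 0, 0], (WithLp.toLp 2 ![0, 3 / 5, 4 / 5] : EuclideanSpace ℝ (Fin 3))⟫_ℝ = 7 * s / 25 := by
    rw [smul_vec3, add_vec3, sub_vec3, inner_vec3]; ring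
  have h2 : ‖((WithLp.toLp 2 ![-(2 / 25), 0, 0] : EuclideanSpace ℝ (Fin 3)) + s • WithLp.toLp 2 ![0, -(3 / 5), 4 / 5]
        - WithLp.toLp 2 ![2 / 25, 0, 0]) - (7 * s / 25) • (WithLp.toLp 2 ![0, 3 / 5, 4 / 5] : EuclideanSpace ℝ (Fin 3))‖ ^ 2
      = 16 / 625 * (1 + 36 * s ^ 2) := by
    rw [smul_vec3, smul_vec3, add_vec3, sub_vec3, sub_vec3, VortexFilament.norm_sq_toLp_three]; ring
  have h3 : ⟪cross (WithLp.toLp 2 ![0, 3 / 5, 4 / 5])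
        (((WithLp.toLp 2 ![-(2 / 25), 0, 0] : EuclideanSpace ℝ (Fin 3)) + s • WithLp.toLp 2 ![0, -(3 / 5), 4 / 5]
          - WithLp.toLp 2 ![2 / 25, 0, 0]) - (7 * s / 25) • (WithLp.toLp 2 ![0, 3 / 5, 4 / 5] : EuclideanSpace ℝ (Fin 3))),
      (WithLp.toLp 2 ![0, -(3 / 5), 4 / 5] : EuclideanSpace ℝ (Fin 3))⟫_ℝ = 96 / 625 := by
    rw [smul_vec3, smul_vec3, add_vec3, sub_vec3, sub_vec3, cross_vec3, inner_vec3]; ring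
  have h4 : ⟪(WithLp.toLp 2 ![-(2 / 25), 0, 0] : EuclideanSpace ℝ (Fin 3)) + s • WithLp.toLp 2 ![0, -(3 / 5), 4 / 5],
      (WithLp.toLp 2 ![0, -(3 / 5), 4 / 5] : EuclideanSpace ℝ (Fin 3))⟫_ℝ = s := by
    rw [smul_vec3, add_vec3, inner_vec3]; ring
  have h5 : ⟪cross (EuclideanSpace.single 2 1)
        ((WithLp.toLp 2 ![-(2 / 25), 0, 0] : EuclideanSpace ℝ (Fin 3)) + s • WithLp.toLp 2 ![0, -(3 / 5), 4 / 5]),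
      (WithLp.toLp 2 ![0, -(3 / 5), 4 / 5] : EuclideanSpace ℝ (Fin 3))⟫_ℝ = 6 / 125 := by
    rw [single_two_eq_vec3, smul_vec3, add_vec3, cross_vec3, inner_vec3]; ring
  rw [h1, inner_sub_left, inner_add_left, real_inner_smul_left, real_inner_smul_left, real_inner_smul_left,
    real_inner_smul_left, h2, h3, h4, h5]
  have hπ : Real.pi ≠ 0 := Real.pi_ne_zero
  have hq : (1 : ℝ) + 36 * s ^ 2 ≠ 0 := by positivity
  field_simp
  ring

/-! ### §2 The registered stub, statement `StraightDatumExists` unfolded verbatim -/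

/-- **STUB S1 `stub_straightDatum` of line `near_straight_newton` (crux `SkeletonJ1G`, stmt-27849): a straight skew
datum exists** — the statement `StraightDatumExists` of `Cruxes/SkeletonJ1/Lines/near_straight_newton.lean` with the
predicate `StraightDatum` unfolded verbatim.  Witness: `N = 2`, `δ = 1/4`, `ρ = 4/25`, `Λ = 22`, `Rw = 3/5`,
`θ₀ = 1/6`, `mw = 1/10`, `p = ((2/25,0,0), (−2/25,0,0))`, `t = ((0,3/5,4/5), (0,−3/5,4/5))`, `γ ≡ 125π/108`,
`α = 875/432`, `s₀ ≡ −1/2`; the scaled slip of both lines is `(125/36)/(1+36s²) + s/2 − 7/72` (§1), whose zero,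
transversality, slope at the zero and slope bound are part 1/2.  A Γ-free finite-dimensional datum; nothing about
Navier–Stokes regularity or blow-up. [folklore] -/
theorem stub_straightDatum :
    ∃ (N : ℕ) (δ ρ Λ Rw θ₀ mw : ℝ) (p t : Fin N → EuclideanSpace ℝ (Fin 3)) (γ : Fin N → ℝ) (α : ℝ) (s₀ : Fin N → ℝ),
    0 < N ∧ 0 < δ ∧ 0 < ρ ∧ 0 < Rw ∧ 0 < θ₀ ∧ 0 < mw ∧
    ((∀ j, ‖t j‖ = 1) ∧
  (∀ j k, j ≠ k → ∀ τ σ : ℝ, ρ ≤ ‖(p j + τ • t j) - (p k + σ • t k)‖) ∧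
  (∀ j, |⟪t j, EuclideanSpace.single 2 1⟫_ℝ| ≤ 1 - θ₀) ∧
  (θ₀ ≤ |α| ∧ |α| ≤ θ₀⁻¹ ∧ ∀ j, θ₀ ≤ |γ j| ∧ |γ j| ≤ θ₀⁻¹) ∧
  (∀ j, ‖p j + s₀ j • t j‖ ≤ Rw) ∧
  (∀ W : Fin N → ℝ → ℝ,
    (∀ j s, W j s = ⟪(∑ k ∈ Finset.univ.erase j, (γ k / (2 * Real.pi)) •
        ((‖(p j + s • t j - p k) - ⟪p j + s • t j - p k, t k⟫_ℝ • t k‖ ^ 2)⁻¹ •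
          cross (t k) ((p j + s • t j - p k) - ⟪p j + s • t j - p k, t k⟫_ℝ • t k))) +
        (1 / 2 : ℝ) • (p j + s • t j) - α • cross (EuclideanSpace.single 2 1) (p j + s • t j), t j⟫_ℝ) →
    ∀ j, W j (s₀ j) = 0 ∧ (∀ s, mw * |s - s₀ j| ≤ |W j s|) ∧ 3 / 2 + δ ≤ deriv (W j) (s₀ j) ∧
      (∀ s, |deriv (W j) s| ≤ Λ))) := by
  refine ⟨2, 1 / 4, 4 / 25, 22, 3 / 5, 1 / 6, 1 / 10,
    ![(WithLp.toLp 2 ![2 / 25, 0, 0] : EuclideanSpace ℝ (Fin 3)), WithLp.toLp 2 ![-(2 / 25), 0, 0]],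
    ![(WithLp.toLp 2 ![0, 3 / 5, 4 / 5] : EuclideanSpace ℝ (Fin 3)), WithLp.toLp 2 ![0, -(3 / 5), 4 / 5]],
    fun _ => 125 * Real.pi / 108, 875 / 432, fun _ => -1 / 2,
    by norm_num, by norm_num, by norm_num, by norm_num, by norm_num, by norm_num, ?_, ?_, ?_, ?_, ?_, ?_⟩
  · -- unit tangents
    intro j
    fin_cases j
    · simp only [Fin.zero_eta, Fin.isValue, Matrix.cons_val_zero]
      exact norm_tangent_zero
    · simp only [Fin.mk_one, Fin.isValue, Matrix.cons_val_one, Matrix.cons_val_zero]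
      exact norm_tangent_one
  · -- pairwise separation of the two lines
    intro j k hjk τ σ
    fin_cases j <;> fin_cases k
    · exact absurd rfl hjk
    · simp only [Fin.zero_eta, Fin.mk_one, Fin.isValue, Matrix.cons_val_zero, Matrix.cons_val_one]
      exact separation_zero_one τ σ
    · simp only [Fin.zero_eta, Fin.mk_one, Fin.isValue, Matrix.cons_val_zero, Matrix.cons_val_one]
      exact separation_one_zero τ σ
    · exact absurd rfl hjk
  · -- tilt margin θ₀ = 1/6
    intro j
    fin_cases j
    · simp only [Fin.zero_eta, Fin.isValue, Matrix.cons_val_zero]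
      exact tilt_zero
    · simp only [Fin.mk_one, Fin.isValue, Matrix.cons_val_one, Matrix.cons_val_zero]
      exact tilt_one
  · -- parameter bounds
    refine ⟨by norm_num, by norm_num, fun _ => ?_⟩
    exact gamma_bounds
  · -- waist
    intro j
    fin_cases j
    · simp only [Fin.zero_eta, Fin.isValue, Matrix.cons_val_zero]
      exact waist_zero
    · simp only [Fin.mk_one, Fin.isValue, Matrix.cons_val_one, Matrix.cons_val_zero]
      exact waist_one
  · -- the scaled slip: closed form on each line, then zero / transversality / slope / slope bound
    intro W hW
    have he0 : Finset.univ.erase (0 : Fin 2) = {1} := by decide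
    have he1 : Finset.univ.erase (1 : Fin 2) = {0} := by decide
    have key0 : ∀ s, W 0 s = 125 / 36 / (1 + 36 * s ^ 2) + s / 2 - 7 / 72 := by
      intro s
      rw [hW, he0, Finset.sum_singleton]
      simp only [Fin.isValue, Matrix.cons_val_zero, Matrix.cons_val_one]
      exact slip_closed_form_zero s
    have key1 : ∀ s, W 1 s = 125 / 36 / (1 + 36 * s ^ 2) + s / 2 - 7 / 72 := by
      intro s
      rw [hW, he1, Finset.sum_singleton]
      simp only [Fin.isValue, Matrix.cons_val_zero, Matrix.cons_val_one]
      exact slip_closed_form_one s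
    have hf0 : W 0 = fun s => 125 / 36 / (1 + 36 * s ^ 2) + s / 2 - 7 / 72 := funext key0
    have hf1 : W 1 = fun s => 125 / 36 / (1 + 36 * s ^ 2) + s / 2 - 7 / 72 := funext key1
    intro j
    fin_cases j
    · simp only [Fin.zero_eta, Fin.isValue]
      refine ⟨?_, ?_, ?_, ?_⟩
      · rw [key0]; norm_num
      · intro s; rw [key0]; exact slip_transversal s
      · rw [hf0]; exact deriv_slip_zero.symm.le
      · intro s; rw [hf0]; exact abs_deriv_slip_le s
    · simp only [Fin.mk_one, Fin.isValue]
      refine ⟨?_, ?_, ?_, ?_⟩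
      · rw [key1]; norm_num
      · intro s; rw [key1]; exact slip_transversal s
      · rw [hf1]; exact deriv_slip_zero.symm.le
      · intro s; rw [hf1]; exact abs_deriv_slip_le s

end Summit.NavierStokesRegularity.NavierStokesRegularity.Theorems.FilamentSkeletonRssSkeletonJ1GStubStraightDatum
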